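import Literature.ModelTheory.FiniteModelTheory.CohomologicalConsistencyLimits
import Literature.ModelTheory.FiniteModelTheory.SparseOrInstance
import Literature.ModelTheory.FiniteModelTheory.CohomologicalConsistencyTransport
import Literature.ModelTheory.FiniteModelTheory.SparseOrData
import HarnessLib

/-!
# The `OR_⊥` template of Lichter–Pago in table format

Topic `Literature/ModelTheory/FiniteModelTheory`; support file for the discharge of
`LichterPago2025_cohomologyFooled` (`CohomologicalConsistencyLimits.lean`).  The template
`OR_⊥(𝔽₂-equations, 𝔽₃-equations)` (`OrLinTemplate`, 7 elements; `SparseOrInstance.lean`) over the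
vocabulary `lpVocab = [3,3,3,3,3,2]` (`R¹₀, R¹₁, R²₀, R²₁, R²₂, S`) as tables `lpTemplate : RelTables
lpVocab 7`, and, for ANY `orLinLanguage`-structure `M` on a type `A` numbered by `e : Fin N ≃ A`, its
tables `pullTables M e : RelTables lpVocab N` (the pull-back of `M` along `e` and the symbol names
`sym`), with the dictionary:

* `relMap_lpTemplate`, `relMap_pullTables` — the table structures are the pull-backs;
* `hasHomTo_pullTables_iff` — `HasHomTo (pullTables M e) lpTemplate ↔ Nonempty (A →[orLinLanguage] OrLinTemplate)`;
* `cohomologyAccepts_pullTables` — cohomological `k`-consistency of `(A, M)` w.r.t. `OrLinTemplate`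
  gives `CohomologyAccepts k (pullTables M e) lpTemplate` (`CohomologicallyKConsistent.transport`).

and the FOOLING HALF of [LichterPago2025, Thm 5.9] for this template (with the repaired, sparse
instances of `SparseOrInstance.lean` / `SparseOrData.lean` in place of the printed ones, which the
algorithm rejects — `OrConstructionObstruction.lean`):

* `exists_fooling` — for `t ≥ 1728⁴` an unsatisfiable table instance with `N ∈ [384t, 480t]` elements
  accepted at every level `k` with `4 · 115202 · k ≤ 192t/1728⁴`;
* `lp_not_cohomologySolves` — **for every sublinear `k` the cohomological `k`-consistency algorithm does
  not solve `CSP(lpTemplate)`**.  (NP-completeness of `CSP(lpTemplate)` and the discharge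
  `LichterPago2025_cohomologyFooled_holds` follow in `CohomologicalConsistencyLimitsProofs.lean`.)

## References

* [LichterPago2025] M. Lichter, B. Pago, arXiv:2407.09097, §3.2 and Thm 5.9 (the template).
* [OConghaile2022] A. Ó Conghaile, arXiv:2206.15253, Def. 5.
-/

namespace Literature.ModelTheory.FiniteModelTheory

open FirstOrder FirstOrder.Language FirstOrder.Language.Structure
open Literature.Computability.Cryptography (relLanguage RelTables structureOfTables)

namespace LPTables

/-! ### The vocabulary and the symbol map -/

/-- The arity list of the vocabulary of `OR_⊥(𝔽₂-equations, 𝔽₃-equations)`: five ternary symbols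
`R¹₀, R¹₁, R²₀, R²₁, R²₂` and the binary link symbol `S`. [cite: LichterPago2025, §3 and Thm 5.9] -/
abbrev lpVocab : List ℕ := [3, 3, 3, 3, 3, 2]

/-- The `orLinLanguage`-symbol named by a position of `lpVocab`. [folklore] -/
def sym : (i : Fin lpVocab.length) → orLinLanguage.Relations (lpVocab.get i)
  | ⟨0, _⟩ => OrRel.inl (LinRel.eq 0)
  | ⟨1, _⟩ => OrRel.inl (LinRel.eq 1)
  | ⟨2, _⟩ => OrRel.inr (LinRel.eq 0)
  | ⟨3, _⟩ => OrRel.inr (LinRel.eq 1)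
  | ⟨4, _⟩ => OrRel.inr (LinRel.eq 2)
  | ⟨5, _⟩ => OrRel.link

/-- The symbol map `φ : (relLanguage lpVocab).Relations n → orLinLanguage.Relations n`. [folklore] -/
def φ {n : ℕ} (r : (relLanguage lpVocab).Relations n) : orLinLanguage.Relations n :=
  r.2 ▸ sym r.1

/-- Every `orLinLanguage`-symbol is named by a position of `lpVocab`. [folklore] -/
theorem φ_surjective {n : ℕ} (r : orLinLanguage.Relations n) :
    ∃ r' : (relLanguage lpVocab).Relations n, φ r' = r := by
  match n, r with
  | _, OrRel.inl (LinRel.eq c) =>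
    fin_cases c
    · exact ⟨⟨⟨0, by decide⟩, rfl⟩, rfl⟩
    · exact ⟨⟨⟨1, by decide⟩, rfl⟩, rfl⟩
  | _, OrRel.inr (LinRel.eq c) =>
    fin_cases c
    · exact ⟨⟨⟨2, by decide⟩, rfl⟩, rfl⟩
    · exact ⟨⟨⟨3, by decide⟩, rfl⟩, rfl⟩
    · exact ⟨⟨⟨4, by decide⟩, rfl⟩, rfl⟩
  | _, OrRel.link => exact ⟨⟨⟨5, by decide⟩, rfl⟩, rfl⟩

/-! ### The template and the instances as tables -/

/-- A numbering of the seven elements of `OR_⊥(𝔽₂, 𝔽₃)`. [folklore] -/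
noncomputable def eT : Fin 7 ≃ OrLinTemplate :=
  (Fintype.equivFinOfCardEq (by rfl : Fintype.card OrLinTemplate = 7)).symm

/-- **The template `OR_⊥(𝔽₂-equations, 𝔽₃-equations)` in table format** (universe `Fin 7`): the
tables of the pull-back of `orTemplateStructure` along `eT` and `sym`.
[cite: LichterPago2025, §3.2 and Thm 5.9 (the template)] -/
noncomputable def lpTemplate : RelTables lpVocab 7 := fun i w =>
  open scoped Classical in
  decide (@RelMap orLinLanguage OrLinTemplate _ _ (sym i) (eT ∘ w))

/-- The template relations, unfolded. [folklore] -/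
theorem relMap_lpTemplate {n : ℕ} (r : (relLanguage lpVocab).Relations n) (y : Fin n → Fin 7) :
    @RelMap (relLanguage lpVocab) (Fin 7) (structureOfTables lpTemplate) n r y ↔
      @RelMap orLinLanguage OrLinTemplate _ n (φ r) (eT ∘ y) := by
  obtain ⟨i, h⟩ := r
  subst h
  show lpTemplate i (y ∘ Fin.cast rfl) = true ↔ _
  unfold lpTemplate
  simp only [decide_eq_true_eq]
  rfl

variable {A : Type}

/-- **The tables of an `orLinLanguage`-structure** `M` on a type `A` numbered by `e : Fin N ≃ A`: the
pull-back of `M` along `e` and the symbol names `sym` (universe `Fin N`).  For the sparse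
OR-instances this is the fooling instance in table format; for the gadget structures of the
reduction from `3SAT` it is the output of the reduction. [folklore] -/
noncomputable def pullTables (M : orLinLanguage.Structure A) {N : ℕ} (e : Fin N ≃ A) :
    RelTables lpVocab N := fun i w =>
  open scoped Classical in
  decide (@RelMap orLinLanguage A M _ (sym i) (e ∘ w))

/-- The pulled-back relations, unfolded. [folklore] -/
theorem relMap_pullTables (M : orLinLanguage.Structure A) {N : ℕ} (e : Fin N ≃ A) {n : ℕ}
    (r : (relLanguage lpVocab).Relations n) (x : Fin n → Fin N) :
    @RelMap (relLanguage lpVocab) (Fin N) (structureOfTables (pullTables M e)) n r x ↔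
      @RelMap orLinLanguage A M n (φ r) (e ∘ x) := by
  obtain ⟨i, h⟩ := r
  subst h
  show pullTables M e i (x ∘ Fin.cast rfl) = true ↔ _
  unfold pullTables
  simp only [decide_eq_true_eq]
  rfl

/-- **Acceptance transports to the tables**: if `(A, M)` is cohomologically `k`-consistent w.r.t.
`OR_⊥` then its table version is accepted at level `k` w.r.t. `lpTemplate`. [cite: OConghaile2022, Def. 5] -/
theorem cohomologyAccepts_pullTables [DecidableEq A] (M : orLinLanguage.Structure A) {N : ℕ}
    (e : Fin N ≃ A) {k : ℕ}
    (h : @CohomologicallyKConsistent orLinLanguage k A OrLinTemplate M _ _) :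
    CohomologyAccepts k (pullTables M e) lpTemplate := by
  unfold CohomologyAccepts
  exact @CohomologicallyKConsistent.transport orLinLanguage (relLanguage lpVocab) k A
    OrLinTemplate (Fin N) (Fin 7) M _ (structureOfTables _)
    (structureOfTables lpTemplate) _ _ e eT φ (relMap_pullTables M e) relMap_lpTemplate h

/-- **Homomorphisms correspond**: the table instance maps to `lpTemplate` iff `(A, M)` maps to
`OR_⊥`. [folklore] -/
theorem hasHomTo_pullTables_iff (M : orLinLanguage.Structure A) {N : ℕ} (e : Fin N ≃ A) :
    HasHomTo (pullTables M e) lpTemplate ↔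
      Nonempty (@FirstOrder.Language.Hom orLinLanguage A OrLinTemplate M _) := by
  constructor
  · rintro ⟨F⟩
    by_contra hno
    have hE := @isEmpty_hom_transport orLinLanguage (relLanguage lpVocab) A OrLinTemplate
      (Fin N) (Fin 7) M _ (structureOfTables (pullTables M e))
      (structureOfTables lpTemplate) _ e eT φ φ_surjective (relMap_pullTables M e)
      relMap_lpTemplate ⟨fun F' => hno ⟨F'⟩⟩
    exact hE.false F
  · rintro ⟨F⟩
    refine ⟨@FirstOrder.Language.Hom.mk (relLanguage lpVocab) (Fin N) (Fin 7)
      (structureOfTables (pullTables M e)) (structureOfTables lpTemplate)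
      (fun x => eT.symm (F (e x))) (fun {n} f => isEmptyElim f) ?_⟩
    intro n r x hx
    rw [relMap_pullTables] at hx
    have h1 := @FirstOrder.Language.Hom.map_rel orLinLanguage A OrLinTemplate M _ F n (φ r) _ hx
    rw [relMap_lpTemplate]
    convert h1 using 1
    funext i
    simp

/-! ### The fooling instances and the fooling half of Theorem 5.9 -/

section Fooling

open _root_.Filter
open scoped _root_.Topology

/-- **Fooling instances at linear level.**  For every `t ≥ 1728⁴` there is an UNSATISFIABLE
table instance of `lpTemplate` with `N` elements, `384t ≤ N ≤ 480t`, ACCEPTED by the cohomological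
`k`-consistency algorithm for every `k` with `4 · 115202 · k ≤ 192t / 1728⁴`: the sparse
OR-instance on the data of `SparseOrData.exists_data t` (`SparseOr.isEmpty_hom`,
`SparseOr.cohomologicallyKConsistent`), transported to tables by `hasHomTo_pullTables_iff` and
`cohomologyAccepts_pullTables`. [cite: LichterPago2025, Thm 5.9 (repaired instances)] -/
theorem exists_fooling (t : ℕ) (ht : 1728 ^ 4 ≤ t) :
    ∃ (N : ℕ) (R : RelTables lpVocab N), 384 * t ≤ N ∧ N ≤ 480 * t ∧
      ¬ HasHomTo R lpTemplate ∧
        ∀ k : ℕ, 4 * (115200 + 2) * k ≤ 192 * t / 1728 ^ 4 → CohomologyAccepts k R lpTemplate := by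
  obtain ⟨V, _, _, S, b₂, b₃, G, _, hlo, hhi, hS3, hexp, hdeg, hdeg', hrob₂, hrob₃, hmix⟩ :=
    SparseOrData.exists_data t ht
  have hr : 1 ≤ 192 * t / 1728 ^ 4 := by
    rw [Nat.le_div_iff_mul_le (by positivity)]; omega
  let N := Fintype.card (V ⊕ V)
  let e : Fin N ≃ V ⊕ V := (Fintype.equivFin (V ⊕ V)).symm
  refine ⟨N, pullTables (sparseOrStructure S b₂ b₃ G) e, ?_, ?_, ?_, fun k hk => ?_⟩
  · show 384 * t ≤ Fintype.card (V ⊕ V); rw [Fintype.card_sum]; omega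
  · show Fintype.card (V ⊕ V) ≤ 480 * t; rw [Fintype.card_sum]; omega
  · exact fun hh => ((hasHomTo_pullTables_iff _ e).1 hh).elim fun F =>
      (SparseOr.isEmpty_hom hS3 (z₀ := t) (fun Z hZ x => hrob₂ Z hZ x) (fun Z hZ x => hrob₃ Z hZ x)
        hmix).false F
  · exact cohomologyAccepts_pullTables (sparseOrStructure S b₂ b₃ G) e
      (SparseOr.cohomologicallyKConsistent (S := S) (b₂ := b₂) (b₃ := b₃) (G := G)
        (r := 192 * t / 1728 ^ 4) (k := k) hS3 hr hexp hdeg hdeg' hk)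

/-- **Lichter–Pago, Theorem 5.9, fooling half, for the explicit template: for every sublinear `k`
the cohomological `k`-consistency algorithm does not solve `CSP(lpTemplate)`.**  Given `k` with
`k(n)/n → 0`, choose `t ≥ 1728⁴` so large that `k(N) · (480 · 4 · 115202 · 1728⁴ + 1) < N` for all
`N ≥ 384t`; the instance of `exists_fooling t` (`N ≤ 480t`) is then accepted at level `k(N)` and
is unsatisfiable. [cite: LichterPago2025, Thm 5.9] -/
theorem lp_not_cohomologySolves (k : ℕ → ℕ)
    (hk : Tendsto (fun n : ℕ => (k n : ℝ) / n) atTop (𝓝 0)) : ¬ CohomologySolves k lpTemplate := by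
  -- the constant `C` with `C · k(N) < N ≤ 480 t ⇒ 4 (d+2) k(N) ≤ 192 t / 1728⁴`
  set C : ℕ := 480 * (4 * (115200 + 2)) * 1728 ^ 4 + 1 with hC
  have hCpos : (0 : ℝ) < C := by positivity
  -- eventually `k n / n < 1/C`
  have hev : ∀ᶠ n : ℕ in atTop, (k n : ℝ) / n < 1 / C :=
    (tendsto_order.1 hk).2 _ (by positivity)
  obtain ⟨n₀, hn₀⟩ := eventually_atTop.1 hev
  set t : ℕ := max (1728 ^ 4) n₀ with htdef
  have ht : 1728 ^ 4 ≤ t := le_max_left _ _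
  have htn : n₀ ≤ t := le_max_right _ _
  rw [not_cohomologySolves_iff]
  -- the level at the (yet unknown) size `N` is small enough, using only `384 t ≤ N ≤ 480 t`
  suffices h : ∀ N : ℕ, 384 * t ≤ N → N ≤ 480 * t →
      4 * (115200 + 2) * k N ≤ 192 * t / 1728 ^ 4 by
    obtain ⟨N, R, hlo, hhi, hno, hacc⟩ := exists_fooling t ht
    exact ⟨N, R, hno, hacc (k N) (h N hlo hhi)⟩
  intro N hlo hhi
  have hNpos : (0 : ℝ) < N := by
    have : 0 < N := lt_of_lt_of_le (by positivity) hlo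
    exact_mod_cast this
  have h1 := hn₀ N (htn.trans (le_trans (by omega) hlo))
  rw [div_lt_div_iff₀ hNpos hCpos, one_mul] at h1
  -- `k N * C < N ≤ 480 t`
  have h2 : k N * C < 480 * t := by
    have : (k N * C : ℝ) < N := by exact_mod_cast h1
    have h3 : (k N * C : ℝ) < (480 * t : ℕ) := this.trans_le (by exact_mod_cast hhi)
    exact_mod_cast h3
  rw [Nat.le_div_iff_mul_le (by positivity)]
  rw [hC] at h2
  nlinarith [h2]

end Fooling

end LPTables

end Literature.ModelTheory.FiniteModelTheory
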